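/-
Copyright (c) 2026 the pub-hodgecm-mathlib formalisation cell (harness21).  Prover seat hodgecm-mathlib-K2E3-p05 (g2), Track B «K2-LIT», engine E3, unit U4 «Keys»,
2026-09-04.  KERNEL module: THEOREMS ONLY (no definition, no named fact, no `sorry`, no instance, no notation).
-/
import Summits.HodgeConjecture.HodgeConjecture.Theorems.K2E3IwahoriFactorisationThree   -- ★-filed p856274 (this seat): `coe_inf_eq_mul` (Iwahori factorisation of `I`), ★ FILE 1∕2
import Summits.HodgeConjecture.HodgeConjecture.Theorems.F0P3CMBorelIwahoriDatum          -- ★ (B-p04): `galAdicCompletionMap_involutive`; brings ★ `iwahoriDatumU3`, `exists_pow_inv_conj_Nbar_le`, `coe_comap_congruenceGL_eq_mul`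
import Literature.NumberTheory.Automorphic.UnitaryLatticeTreeLevelIndices                 -- ★ p852870: `isOpen_glInt_inf_conj_glInt_subgroupOf`, `isCompact_glInt_inf_conj_glInt_subgroupOf`
import Literature.NumberTheory.Automorphic.ValuedFieldValuativeRelBridge                  -- ★ `v_le_iff_valuation_le`, `v_le_one_iff_valuation_le_one`
import Literature.NumberTheory.Automorphic.AdicCompletionCompact                          -- ★ `compactSpace_integer_adicCompletion`
import HarnessLib

/-!
# K2 ∕ E3 «EllipticInputs», unit U4 «Keys» — Road II of MEMO `hK-KeysThmTwo`, stub II-3 (second brick) «THE IWAHORI DATUM AT LEVEL `I`»: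
# an Iwahori datum for the Borel of `U(σ_w, Φ₃)(L_w)` whose FIRST level is the Iwahori subgroup `I = K₀ ⊓ K₁` (then the principal congruence levels)
# [Casselman1995 Prop. 1.4.4, Thm. 3.3.3; BruhatTits1972 (4.4.3)–(4.4.4); Borel1976 §3–§4]

Cell hodgecm-mathlib (D-0151), FLOOR 0, Track B «K2-LIT», engine E3, crux item H413 = stmt-HodgeConjecture-24833 (route `HCCMUnconditional`, no route verbs); target BY NAME
`…K2E3EllipticInputs.U4Keys.sig_K2E3KeysThmTwoContracting` (U4-f), unramified first rung (Road II), DETECTION step II-3: Jacquet's lemma ★ `JacquetLemma.fixedPoints_jacquetModule_le_map`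
at the level `I` needs a ★ `ParabolicTriple.IwahoriDatum` with `K 0 = I`.  ★ `iwahoriDatumU3` (F0P3-p01) is the datum at the principal congruence levels `U ∩ K_{γ₀^{j+1}}`; THIS FILE
prepends the Iwahori level: `K 0 := I`, `K (j+1) := U ∩ K_{γ₀^{j+1}}` with `γ₀ = |ϖ|_w`, using the Iwahori factorisation ★-filed `K2E3IwahoriFactorisationThree.coe_inf_eq_mul` for the new
`factorization` field and two inclusions for the contraction field: `U ∩ K_{|ϖ|} ≤ I` (an element `≡ 1 mod 𝔭` is integral with `(2,0)` entry in `𝔭`: Hermitian upgrade) and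
`I ∩ N̄ ≤ U ∩ K_{|ϖ|}` (a lower unitriangular element of `I` is `≡ 1 mod 𝔭`).  Written at the place `w ∣ v` of the CM field (`σ_w = galAdicCompletionMap c`, `hd : UnramifiedLocalConjDatum σ_w ϖ`),
where the `Valued` and `ValuativeRel` structures of `L_w` are the canonical compatible ones; the transport to the CM carrier `Gqs L v` along `eA` and the detection are the sequel.
Author K2E3-p05 (g2).  `--supports stmt-HodgeConjecture-24833 --as helper`; THEOREMS ONLY.
§1 `comap_congruenceGL_le_inf` (`U ∩ K_{|ϖ|} ≤ I`) · `valBound_sub_one_of_mem_inf_inf_Nbar`, `inf_inf_Nbar_le_comap_congruenceGL` (`I ∩ N̄ ≤ U ∩ K_{|ϖ|}`) ·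
§2 `exists_iwahoriDatum_iwahoriLevel` (the datum: `K 0 = I`, `K (j+1) = U ∩ K_{|ϖ|^{j+1}}`, `N̄ = w N w`, ray `s = diag(u)` with ratios `≤ q`).
HONEST LABEL: HC_CM is proved only modulo the 7 printed citations (2 remaining named inputs: hLiu418 = stmt-HodgeConjecture-24832, h413 = stmt-HodgeConjecture-24833)
until rung 0 closes; count-neutral (structure theory; no printed citation is discharged).

## References
* [Casselman1995] W. Casselman, *Introduction to the theory of admissible representations of p-adic reductive groups* (1995), Prop. 1.4.3, Prop. 1.4.4, Thm. 3.3.3.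
* [BruhatTits1972] F. Bruhat, J. Tits, Publ. Math. IHÉS 41 (1972), (4.4.3)–(4.4.4).  * [Borel1976] A. Borel, Invent. Math. 35 (1976), §3–§4.
-/

set_option autoImplicit false
-- the mandated namespace has the single-problem summit's repeated segment (`HodgeConjecture.HodgeConjecture`)
set_option linter.dupNamespace false

noncomputable section

open Matrix ValuativeRel Literature.NumberTheory.Automorphic Literature.NumberTheory.Automorphic.UnitaryGroup
open Literature.NumberTheory.GaloisRepresentations
open scoped Matrix MatrixGroups WithZero Pointwise NumberField
open NumberField IsDedekindDomain

namespace Summit.HodgeConjecture.HodgeConjecture.Cruxes.H413.K2E3IwahoriLevelDatum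

open Summit.HodgeConjecture.HodgeConjecture.Cruxes.H413.K2E3IwahoriFactorisationThree

variable (L : Type) [Field L] [NumberField L] [IsCMField L] (v : HeightOneSpectrum (𝓞 ↥(maximalRealSubfield L)))
  (w : PlacesOver L v) (hw : IsCMField.complexConj L • w.1 = w.1)

/-! ## §1 The two inclusions `U ∩ K_{|ϖ|} ≤ I` and `I ∩ N̄ ≤ U ∩ K_{|ϖ|}` -/

/-- **`U ∩ K_{|ϖ|} ≤ I`**: an element of the principal congruence subgroup of level `𝔭` is integral (★ `congruenceGL_le_glInt`) and its `(2,0)` entry `x₂₀ = (x − 1)₂₀` has valuation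
`≤ |ϖ| < 1`, so the Hermitian upgrade ★ `mem_glInt_inf_conj_glInt_of_v_lt_one` applies. [cite: BruhatTits1972, (4.4.4)] [cite: Casselman1995, Prop. 1.4.4] -/
theorem comap_congruenceGL_le_inf {ϖ : w.1.adicCompletion L}
    (hd : HermitianLattice.UnramifiedLocalConjDatum (galAdicCompletionMap (L := L) (IsCMField.complexConj L) hw) ϖ)
    (g₁ : GL (Fin 3) (w.1.adicCompletion L)) (hg₁ : (g₁ : Matrix (Fin 3) (Fin 3) (w.1.adicCompletion L)) = Matrix.diagonal ![(1 : w.1.adicCompletion L), 1, ϖ])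
    {γ : ValueGroupWithZero (w.1.adicCompletion L)} (hγ : γ ≤ valuation (w.1.adicCompletion L) ϖ) :
    (congruenceGL 3 γ).comap (unitaryGroupOfForm (galAdicCompletionMap (L := L) (IsCMField.complexConj L) hw) ((StdForm.antidiagonal 3).over (w.1.adicCompletion L))).subtype ≤
      (glInt 3 (w.1.adicCompletion L)).subgroupOf (unitaryGroupOfForm (galAdicCompletionMap (L := L) (IsCMField.complexConj L) hw) ((StdForm.antidiagonal 3).over (w.1.adicCompletion L))) ⊓
        ((glInt 3 (w.1.adicCompletion L)).map (MulAut.conj g₁).toMonoidHom).subgroupOf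
          (unitaryGroupOfForm (galAdicCompletionMap (L := L) (IsCMField.complexConj L) hw) ((StdForm.antidiagonal 3).over (w.1.adicCompletion L))) := by
  intro x hx
  have hxc := Subgroup.mem_comap.1 hx
  have hK0 : x ∈ (glInt 3 (w.1.adicCompletion L)).subgroupOf _ := Subgroup.mem_subgroupOf.2 (congruenceGL_le_glInt _ hxc)
  refine mem_glInt_inf_conj_glInt_of_v_lt_one (galAdicCompletionMap (L := L) (IsCMField.complexConj L) hw) rfl hd.vσ hd.vϖ g₁ hg₁ hK0 ?_
  -- `x₂₀ = (x − 1)₂₀` has valuation `≤ γ ≤ |ϖ| < 1`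
  have h20 := (mem_congruenceGL_iff.1 hxc).2.1 2 0
  rw [Matrix.sub_apply, Matrix.one_apply_ne (by decide), sub_zero] at h20
  have hϖ1 : Valued.v ϖ < 1 := by rw [hd.vϖ, ← WithZero.exp_zero, WithZero.exp_lt_exp]; norm_num
  refine lt_of_le_of_lt ((v_le_iff_valuation_le _ _).2 (h20.trans hγ)) hϖ1

/-- For `x ∈ I ∩ N̄` (`N̄ = w N w`): `x` is lower unitriangular (★ `coe_weylLongU_mul_mul_weylLongU_apply'`) with strictly-lower entries in `𝔭` (★ THE IWAHORI TEST), so every entry of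
`x − 1` has valuation `≤ |ϖ|`. [cite: BruhatTits1972, (4.4.3)–(4.4.4)] [cite: Tits1979, §3.7] -/
theorem valBound_sub_one_of_mem_inf_inf_Nbar {ϖ : w.1.adicCompletion L}
    (hd : HermitianLattice.UnramifiedLocalConjDatum (galAdicCompletionMap (L := L) (IsCMField.complexConj L) hw) ϖ)
    (g₁ : GL (Fin 3) (w.1.adicCompletion L)) (hg₁ : (g₁ : Matrix (Fin 3) (Fin 3) (w.1.adicCompletion L)) = Matrix.diagonal ![(1 : w.1.adicCompletion L), 1, ϖ])
    {x : ↥(unitaryGroupOfForm (galAdicCompletionMap (L := L) (IsCMField.complexConj L) hw) ((StdForm.antidiagonal 3).over (w.1.adicCompletion L)))}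
    (hxI : x ∈ (glInt 3 (w.1.adicCompletion L)).subgroupOf (unitaryGroupOfForm (galAdicCompletionMap (L := L) (IsCMField.complexConj L) hw) ((StdForm.antidiagonal 3).over (w.1.adicCompletion L))) ⊓
        ((glInt 3 (w.1.adicCompletion L)).map (MulAut.conj g₁).toMonoidHom).subgroupOf
          (unitaryGroupOfForm (galAdicCompletionMap (L := L) (IsCMField.complexConj L) hw) ((StdForm.antidiagonal 3).over (w.1.adicCompletion L))))
    (hxN : x ∈ ((borelTriple (galAdicCompletionMap (L := L) (IsCMField.complexConj L) hw) ((StdForm.antidiagonal 3).over (w.1.adicCompletion L)) rfl).N).map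
        (MulAut.conj (weylLongU (galAdicCompletionMap (L := L) (IsCMField.complexConj L) hw) (rfl : (StdForm.antidiagonal 3).over (w.1.adicCompletion L) = _))).toMonoidHom) :
    ValBound (valuation (w.1.adicCompletion L) ϖ) ((((x : GL (Fin 3) (w.1.adicCompletion L)) : Matrix (Fin 3) (Fin 3) (w.1.adicCompletion L))) - 1) := by
  obtain ⟨hint, h20, h21, h10⟩ := (mem_glInt_inf_conj_glInt_iff (galAdicCompletionMap (L := L) (IsCMField.complexConj L) hw) rfl hd.vσ hd.vϖ g₁ hg₁ x).1 hxI
  -- `x = w n w⁻¹ = w n w` with `n ∈ N` upper unitriangular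
  obtain ⟨n, hn, hxn⟩ := hxN
  rw [borelTriple_N] at hn
  obtain ⟨htri, hdiag⟩ := (mem_unipotentU_iff n).1 hn
  have hw2 : weylLongU (galAdicCompletionMap (L := L) (IsCMField.complexConj L) hw) (rfl : (StdForm.antidiagonal 3).over (w.1.adicCompletion L) = _) * weylLongU (galAdicCompletionMap (L := L) (IsCMField.complexConj L) hw) rfl = 1 := weylLongU_mul_weylLongU (galAdicCompletionMap (L := L) (IsCMField.complexConj L) hw) rfl
  have hx_eq : x = weylLongU (galAdicCompletionMap (L := L) (IsCMField.complexConj L) hw) rfl * n * weylLongU (galAdicCompletionMap (L := L) (IsCMField.complexConj L) hw) rfl := by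
    rw [← hxn]
    change weylLongU (galAdicCompletionMap (L := L) (IsCMField.complexConj L) hw) rfl * n * (weylLongU (galAdicCompletionMap (L := L) (IsCMField.complexConj L) hw) rfl)⁻¹ = _
    rw [inv_eq_of_mul_eq_one_right hw2]
  have hent : ∀ i j, ((x : GL (Fin 3) (w.1.adicCompletion L)) : Matrix (Fin 3) (Fin 3) (w.1.adicCompletion L)) i j =
      ((n : GL (Fin 3) (w.1.adicCompletion L)) : Matrix (Fin 3) (Fin 3) (w.1.adicCompletion L)) (Fin.rev i) (Fin.rev j) := fun i j => by
    rw [hx_eq, coe_weylLongU_mul_mul_weylLongU_apply']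
  have r0 : Fin.rev (0 : Fin 3) = 2 := rfl
  have r1 : Fin.rev (1 : Fin 3) = 1 := rfl
  have r2 : Fin.rev (2 : Fin 3) = 0 := rfl
  have hn10 : ((n : GL (Fin 3) (w.1.adicCompletion L)) : Matrix (Fin 3) (Fin 3) (w.1.adicCompletion L)) 1 0 = 0 := htri (by decide)
  have hn20 : ((n : GL (Fin 3) (w.1.adicCompletion L)) : Matrix (Fin 3) (Fin 3) (w.1.adicCompletion L)) 2 0 = 0 := htri (by decide)
  have hn21 : ((n : GL (Fin 3) (w.1.adicCompletion L)) : Matrix (Fin 3) (Fin 3) (w.1.adicCompletion L)) 2 1 = 0 := htri (by decide)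
  -- `v y < 1 ⇒ valuation y ≤ valuation ϖ` (discreteness)
  have key : ∀ y : w.1.adicCompletion L, Valued.v y < 1 → valuation (w.1.adicCompletion L) y ≤ valuation (w.1.adicCompletion L) ϖ := fun y hy => by
    rw [← v_le_iff_valuation_le, hd.vϖ]; exact (HermitianLattice.v_lt_one_iff y).1 hy
  intro i j
  rw [Matrix.sub_apply]
  fin_cases i <;> fin_cases j
  · simp only [Fin.zero_eta, Matrix.one_apply_eq]
    rw [hent, hdiag, sub_self, map_zero]; exact zero_le
  · simp only [Fin.zero_eta, Fin.mk_one, ne_eq, zero_ne_one, not_false_eq_true, Matrix.one_apply_ne, sub_zero]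
    rw [hent, r0, r1, hn21, map_zero]; exact zero_le
  · simp only [Fin.zero_eta, Fin.reduceFinMk, ne_eq, Fin.reduceEq, not_false_eq_true, Matrix.one_apply_ne, sub_zero]
    rw [hent, r0, r2, hn20, map_zero]; exact zero_le
  · simp only [Fin.mk_one, Fin.zero_eta, ne_eq, one_ne_zero, not_false_eq_true, Matrix.one_apply_ne, sub_zero]
    exact key _ h10
  · simp only [Fin.mk_one, Matrix.one_apply_eq]
    rw [hent, hdiag, sub_self, map_zero]; exact zero_le
  · simp only [Fin.mk_one, Fin.reduceFinMk, ne_eq, Fin.reduceEq, not_false_eq_true, Matrix.one_apply_ne, sub_zero]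
    rw [hent, r1, r2, hn10, map_zero]; exact zero_le
  · simp only [Fin.reduceFinMk, Fin.zero_eta, ne_eq, Fin.reduceEq, not_false_eq_true, Matrix.one_apply_ne, sub_zero]
    exact key _ h20
  · simp only [Fin.reduceFinMk, Fin.mk_one, ne_eq, Fin.reduceEq, not_false_eq_true, Matrix.one_apply_ne, sub_zero]
    exact key _ h21
  · simp only [Fin.reduceFinMk, Matrix.one_apply_eq]
    rw [hent, hdiag, sub_self, map_zero]; exact zero_le

/-- **`I ∩ N̄ ≤ U ∩ K_{|ϖ|}`** (`N̄ = w N w`): both `x` and `x⁻¹` lie in `I ∩ N̄`, so `x`, `x⁻¹` are integral and `x − 1`, `x⁻¹ − 1` have entries in `𝔭` (previous lemma).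
[cite: BruhatTits1972, (4.4.3)–(4.4.4)] [cite: Casselman1995, Prop. 1.4.3] -/
theorem inf_inf_Nbar_le_comap_congruenceGL {ϖ : w.1.adicCompletion L}
    (hd : HermitianLattice.UnramifiedLocalConjDatum (galAdicCompletionMap (L := L) (IsCMField.complexConj L) hw) ϖ)
    (g₁ : GL (Fin 3) (w.1.adicCompletion L)) (hg₁ : (g₁ : Matrix (Fin 3) (Fin 3) (w.1.adicCompletion L)) = Matrix.diagonal ![(1 : w.1.adicCompletion L), 1, ϖ]) :
    ((glInt 3 (w.1.adicCompletion L)).subgroupOf (unitaryGroupOfForm (galAdicCompletionMap (L := L) (IsCMField.complexConj L) hw) ((StdForm.antidiagonal 3).over (w.1.adicCompletion L))) ⊓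
        ((glInt 3 (w.1.adicCompletion L)).map (MulAut.conj g₁).toMonoidHom).subgroupOf
          (unitaryGroupOfForm (galAdicCompletionMap (L := L) (IsCMField.complexConj L) hw) ((StdForm.antidiagonal 3).over (w.1.adicCompletion L)))) ⊓
      ((borelTriple (galAdicCompletionMap (L := L) (IsCMField.complexConj L) hw) ((StdForm.antidiagonal 3).over (w.1.adicCompletion L)) rfl).N).map
        (MulAut.conj (weylLongU (galAdicCompletionMap (L := L) (IsCMField.complexConj L) hw) (rfl : (StdForm.antidiagonal 3).over (w.1.adicCompletion L) = _))).toMonoidHom ≤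
      (congruenceGL 3 (valuation (w.1.adicCompletion L) ϖ)).comap
        (unitaryGroupOfForm (galAdicCompletionMap (L := L) (IsCMField.complexConj L) hw) ((StdForm.antidiagonal 3).over (w.1.adicCompletion L))).subtype := by
  intro x hx
  obtain ⟨hxI, hxN⟩ := Subgroup.mem_inf.1 hx
  have hxI' : x⁻¹ ∈ _ := Subgroup.inv_mem _ hxI
  have hxN' : x⁻¹ ∈ _ := Subgroup.inv_mem _ hxN
  have hint := (mem_glInt_subgroupOf_iff (galAdicCompletionMap (L := L) (IsCMField.complexConj L) hw) rfl hd.vσ x).1 (Subgroup.mem_inf.1 hxI).1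
  have hint' := (mem_glInt_subgroupOf_iff (galAdicCompletionMap (L := L) (IsCMField.complexConj L) hw) rfl hd.vσ x⁻¹).1 (Subgroup.mem_inf.1 hxI').1
  refine Subgroup.mem_comap.2 (mem_congruenceGL_iff.2 ⟨⟨fun i j => ?_, fun i j => ?_⟩,
    valBound_sub_one_of_mem_inf_inf_Nbar L v w hw hd g₁ hg₁ hxI hxN, ?_⟩)
  · exact (v_le_one_iff_valuation_le_one _).1 (hint i j)
  · have h := (v_le_one_iff_valuation_le_one _).1 (hint' i j)
    rwa [Subgroup.coe_inv] at h
  · have h := valBound_sub_one_of_mem_inf_inf_Nbar L v w hw hd g₁ hg₁ hxI' hxN'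
    rwa [Subgroup.coe_inv] at h

/-! ## §2 The Iwahori datum at level `I` -/

/-- **THE IWAHORI DATUM OF THE BOREL OF `U(σ_w, Φ₃)(L_w)` AT LEVEL `I`**: levels `K 0 = I = K₀ ⊓ K₁`, `K (j+1) = U ∩ K_{|ϖ|^{j+1}}`; opposite radical `N̄ = w N w`; ray any diagonal
`s = diag(u) ∈ U` with `|uᵢ∕uⱼ| ≤ q` (`i < j`, `0 ≠ q < 1`).  Fields: `I` compact open (★ p852870); neighbourhood basis from the congruence levels (★ `exists_comap_congruenceGL_pow_subset`);
factorisation at level `0` = ★-filed `coe_inf_eq_mul` (the Iwahori factorisation), at level `j+1` = ★ `coe_comap_congruenceGL_eq_mul`; contraction `s⁻ⁱ(K_n ∩ N̄)sⁱ ≤ K_j` from ★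
`exists_pow_inv_conj_Nbar_le` through §1's inclusions `I ∩ N̄ ≤ U ∩ K_{|ϖ|}` (source `n = 0`) and `U ∩ K_{|ϖ|} ≤ I` (target `j = 0`).  The input of ★ Jacquet's lemma
`JacquetLemma.fixedPoints_jacquetModule_le_map` AT THE IWAHORI LEVEL: `i_G(χ)^I ↠ r(i_G(χ))^{T ∩ I}`. [cite: Casselman1995, Prop. 1.4.4, Thm. 3.3.3] [cite: Borel1976, §3–§4]
[cite: BruhatTits1972, (4.4.3)–(4.4.4)] -/
theorem exists_iwahoriDatum_iwahoriLevel {ϖ : w.1.adicCompletion L}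
    (hd : HermitianLattice.UnramifiedLocalConjDatum (galAdicCompletionMap (L := L) (IsCMField.complexConj L) hw) ϖ)
    (g₁ : GL (Fin 3) (w.1.adicCompletion L)) (hg₁ : (g₁ : Matrix (Fin 3) (Fin 3) (w.1.adicCompletion L)) = Matrix.diagonal ![(1 : w.1.adicCompletion L), 1, ϖ])
    {q : ValueGroupWithZero (w.1.adicCompletion L)} (hq0 : q ≠ 0) (hq1 : q < 1)
    (s : ↥(unitaryGroupOfForm (galAdicCompletionMap (L := L) (IsCMField.complexConj L) hw) ((StdForm.antidiagonal 3).over (w.1.adicCompletion L))))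
    (u : Fin 3 → (w.1.adicCompletion L)ˣ) (hs : ((s : ↥(unitaryGroupOfForm (galAdicCompletionMap (L := L) (IsCMField.complexConj L) hw) ((StdForm.antidiagonal 3).over (w.1.adicCompletion L)))) :
      GL (Fin 3) (w.1.adicCompletion L)) = glDiagonal 3 (w.1.adicCompletion L) u)
    (hu : ∀ i j : Fin 3, i < j → valuation (w.1.adicCompletion L) ((u i : w.1.adicCompletion L) * ((u j : w.1.adicCompletion L))⁻¹) ≤ q) :
    ∃ 𝓘 : (borelTriple (galAdicCompletionMap (L := L) (IsCMField.complexConj L) hw) ((StdForm.antidiagonal 3).over (w.1.adicCompletion L)) rfl).IwahoriDatum,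
      𝓘.a = s ∧
      𝓘.Nbar = ((borelTriple (galAdicCompletionMap (L := L) (IsCMField.complexConj L) hw) ((StdForm.antidiagonal 3).over (w.1.adicCompletion L)) rfl).N).map
        (MulAut.conj (weylLongU (galAdicCompletionMap (L := L) (IsCMField.complexConj L) hw) (rfl : (StdForm.antidiagonal 3).over (w.1.adicCompletion L) = _))).toMonoidHom ∧
      𝓘.K 0 = (glInt 3 (w.1.adicCompletion L)).subgroupOf (unitaryGroupOfForm (galAdicCompletionMap (L := L) (IsCMField.complexConj L) hw) ((StdForm.antidiagonal 3).over (w.1.adicCompletion L))) ⊓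
        ((glInt 3 (w.1.adicCompletion L)).map (MulAut.conj g₁).toMonoidHom).subgroupOf
          (unitaryGroupOfForm (galAdicCompletionMap (L := L) (IsCMField.complexConj L) hw) ((StdForm.antidiagonal 3).over (w.1.adicCompletion L))) ∧
      ∀ j : ℕ, 𝓘.K (j + 1) = (congruenceGL 3 ((valuation (w.1.adicCompletion L) ϖ) ^ (j + 1))).comap
        (unitaryGroupOfForm (galAdicCompletionMap (L := L) (IsCMField.complexConj L) hw) ((StdForm.antidiagonal 3).over (w.1.adicCompletion L))).subtype := by
  haveI : CompactSpace (Valued.integer (w.1.adicCompletion L)) := compactSpace_integer_adicCompletion L w.1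
  have hσσ : ∀ x, (galAdicCompletionMap (L := L) (IsCMField.complexConj L) hw) ((galAdicCompletionMap (L := L) (IsCMField.complexConj L) hw) x) = x := hd.σσ
  have hσc : Continuous (galAdicCompletionMap (L := L) (IsCMField.complexConj L) hw) := continuous_galAdicCompletionMap (L := L) (IsCMField.complexConj L) hw
  have hϖ0 : ϖ ≠ 0 := CartanUnique.uniformizer_ne_zero hd.vϖ
  have hγ₀0 : valuation (w.1.adicCompletion L) ϖ ≠ 0 := (Valuation.ne_zero_iff _).2 hϖ0
  have hγ₀1 : valuation (w.1.adicCompletion L) ϖ < 1 := by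
    rw [← v_lt_one_iff_valuation_lt_one, hd.vϖ, ← WithZero.exp_zero, WithZero.exp_lt_exp]; norm_num
  have hγpow : ∀ j : ℕ, valuation (w.1.adicCompletion L) ϖ ^ (j + 1) < 1 := fun j => pow_lt_one₀ zero_le hγ₀1 (Nat.succ_ne_zero j)
  have hγpow0 : ∀ j : ℕ, valuation (w.1.adicCompletion L) ϖ ^ (j + 1) ≠ 0 := fun j => pow_ne_zero _ hγ₀0
  have hγpowle : ∀ j : ℕ, valuation (w.1.adicCompletion L) ϖ ^ (j + 1) ≤ valuation (w.1.adicCompletion L) ϖ := fun j => by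
    rw [pow_succ]
    calc valuation (w.1.adicCompletion L) ϖ ^ j * valuation (w.1.adicCompletion L) ϖ ≤ 1 * valuation (w.1.adicCompletion L) ϖ :=
          mul_le_mul' (pow_le_one₀ zero_le hγ₀1.le) le_rfl
      _ = valuation (w.1.adicCompletion L) ϖ := one_mul _
  -- monotonicity of the `ConjAct`-translate of a subgroup
  have hmono : ∀ (c : ConjAct ↥(unitaryGroupOfForm (galAdicCompletionMap (L := L) (IsCMField.complexConj L) hw) ((StdForm.antidiagonal 3).over (w.1.adicCompletion L))))
      (H H' : Subgroup ↥(unitaryGroupOfForm (galAdicCompletionMap (L := L) (IsCMField.complexConj L) hw) ((StdForm.antidiagonal 3).over (w.1.adicCompletion L)))), H ≤ H' → c • H ≤ c • H' := by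
    intro c H H' hle x hx
    rw [Subgroup.mem_pointwise_smul_iff_inv_smul_mem] at hx ⊢
    exact hle hx
  refine ⟨{ Nbar := ((borelTriple (galAdicCompletionMap (L := L) (IsCMField.complexConj L) hw) ((StdForm.antidiagonal 3).over (w.1.adicCompletion L)) rfl).N).map (MulAut.conj (weylLongU (galAdicCompletionMap (L := L) (IsCMField.complexConj L) hw) rfl)).toMonoidHom
            a := s
            a_mem := by rw [borelTriple_M, mem_torusU_iff]; exact ⟨u, hs.symm⟩
            a_comm := fun m hm => by
              rw [borelTriple_M] at hm
              have h := torusU_mul_comm (galAdicCompletionMap (L := L) (IsCMField.complexConj L) hw) ((StdForm.antidiagonal 3).over (w.1.adicCompletion L)) ⟨m, hm⟩ ⟨s, by rw [mem_torusU_iff]; exact ⟨u, hs.symm⟩⟩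
              exact congrArg Subtype.val h
            K := fun n => match n with
              | 0 => (glInt 3 (w.1.adicCompletion L)).subgroupOf (unitaryGroupOfForm (galAdicCompletionMap (L := L) (IsCMField.complexConj L) hw) ((StdForm.antidiagonal 3).over (w.1.adicCompletion L))) ⊓
                  ((glInt 3 (w.1.adicCompletion L)).map (MulAut.conj g₁).toMonoidHom).subgroupOf (unitaryGroupOfForm (galAdicCompletionMap (L := L) (IsCMField.complexConj L) hw) ((StdForm.antidiagonal 3).over (w.1.adicCompletion L)))
              | (j + 1) => (congruenceGL 3 ((valuation (w.1.adicCompletion L) ϖ) ^ (j + 1))).comap (unitaryGroupOfForm (galAdicCompletionMap (L := L) (IsCMField.complexConj L) hw) ((StdForm.antidiagonal 3).over (w.1.adicCompletion L))).subtype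
            isOpen_K := fun n => match n with
              | 0 => UnitaryLatticeTree.isOpen_glInt_inf_conj_glInt_subgroupOf (galAdicCompletionMap (L := L) (IsCMField.complexConj L) hw) ((StdForm.antidiagonal 3).over (w.1.adicCompletion L)) g₁
              | (j + 1) => (isCompact_isOpen_comap_congruenceGL (galAdicCompletionMap (L := L) (IsCMField.complexConj L) hw) (J := (StdForm.antidiagonal 3).over (w.1.adicCompletion L)) hσc (hγpow0 j)).2
            isCompact_K := fun n => match n with
              | 0 => UnitaryLatticeTree.isCompact_glInt_inf_conj_glInt_subgroupOf (galAdicCompletionMap (L := L) (IsCMField.complexConj L) hw) ((StdForm.antidiagonal 3).over (w.1.adicCompletion L)) g₁ hσc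
              | (j + 1) => (isCompact_isOpen_comap_congruenceGL (galAdicCompletionMap (L := L) (IsCMField.complexConj L) hw) (J := (StdForm.antidiagonal 3).over (w.1.adicCompletion L)) hσc (hγpow0 j)).1
            hasBasis_K := fun O hO => by
              obtain ⟨j, hj⟩ := exists_comap_congruenceGL_pow_subset (galAdicCompletionMap (L := L) (IsCMField.complexConj L) hw) hγ₀0 hγ₀1 hO
              exact ⟨j + 1, hj⟩
            factorization := fun n => match n with
              | 0 => coe_inf_eq_mul (galAdicCompletionMap (L := L) (IsCMField.complexConj L) hw) rfl hσσ hd.vσ hd.vϖ g₁ hg₁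
              | (j + 1) => coe_comap_congruenceGL_eq_mul (galAdicCompletionMap (L := L) (IsCMField.complexConj L) hw) rfl (hγpow j)
            exists_conj_inf_Nbar_le := ?_ }, rfl, rfl, rfl, fun j => rfl⟩
  -- the contraction, through the two inclusions of §1
  have hIN := inf_inf_Nbar_le_comap_congruenceGL L v w hw hd g₁ hg₁
  have hcI := comap_congruenceGL_le_inf L v w hw hd g₁ hg₁ (le_refl (valuation (w.1.adicCompletion L) ϖ))
  intro n j
  match n, j with
  | 0, 0 =>
      obtain ⟨i, hi⟩ := exists_pow_inv_conj_Nbar_le (galAdicCompletionMap (L := L) (IsCMField.complexConj L) hw) rfl hq0 hq1 hγ₀1 hγ₀0 s u hs hu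
      refine ⟨i, le_trans (le_trans (hmono _ _ _ ?_) hi) hcI⟩
      exact fun x hx => Subgroup.mem_inf.2 ⟨hIN hx, (Subgroup.mem_inf.1 hx).2⟩
  | 0, (j + 1) =>
      obtain ⟨i, hi⟩ := exists_pow_inv_conj_Nbar_le (galAdicCompletionMap (L := L) (IsCMField.complexConj L) hw) rfl hq0 hq1 hγ₀1 (hγpow0 j) s u hs hu
      refine ⟨i, le_trans (hmono _ _ _ ?_) hi⟩
      exact fun x hx => Subgroup.mem_inf.2 ⟨hIN hx, (Subgroup.mem_inf.1 hx).2⟩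
  | (n + 1), 0 =>
      obtain ⟨i, hi⟩ := exists_pow_inv_conj_Nbar_le (galAdicCompletionMap (L := L) (IsCMField.complexConj L) hw) rfl hq0 hq1 (hγpow n) hγ₀0 s u hs hu
      exact ⟨i, le_trans hi hcI⟩
  | (n + 1), (j + 1) =>
      exact exists_pow_inv_conj_Nbar_le (galAdicCompletionMap (L := L) (IsCMField.complexConj L) hw) rfl hq0 hq1 (hγpow n) (hγpow0 j) s u hs hu
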